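import Mathlib
import HarnessLib
import Summits.HubbardSuperconductivity.HubbardSuperconductivity.Theorems.KLProgrammeKLRegimeEngineGeneralStepResponseFitOfPosPurePrimed
import Summits.HubbardSuperconductivity.HubbardSuperconductivity.Theorems.KLProgrammeKLRegimeFlowReadPrivStep

/-!
# K3 gen-8-FLOW (stmt 20437, stub (C), cure «(B)-MAIN-PURE»): the (P)-STEP of the private two-conjunct induction at a GENERAL scale with the (B) bracket
# DISCHARGED BY NAME (primed booking) — `twoLegReadPriv_flow_succ_of_pos_pure` (cell gate-hubbard-kl, seat p2 g22)

= k3c3-p1's «(P)-STEP» `…FlowReadPrivStep.twoLegReadPriv_flow_succ` (p598604) at scale `n := m` (`m + 1 ≤ n_β`) ∘ `…ResponseFitOfPosPurePrimed.frameResponse_hB_flow_of_pos_pure_primed`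
(p658138): the (B) door's `(hBdiff, hB)` pair is produced inside from the pure-moment general-step door, with tables `eB := 0`, `eB′ := (X 0, readJetC X · + readJetC′ R X ·)`
— the general-step twin of p2 g21's last-index one call `twoLegRead_flow_last_registered_of_pos` (p649639).  What the (C)/(P) closer still feeds per scale: the volume guard
`4·klFlowDeg(m+1) ≤ L`, (A) `hA/hAval` (c4a-1), (C2) `hTdiff/hT` (`transport_jets_flow_fit`, `eT 0 = 0`), (C1) `hJdiff/hJ` (`eJ 0 = 0`), the regime / `FrameOK` ×2 / `hZ₂,hZ` /
history / envelopes / `klEngL₄ ≤ L`, E1's β-free constants (`cN 0`, `cN l` PURE four-leg; `cS/cSs/cE/cEs` two-leg), a table `X ≥ 0` above the (B) budget expressions, and the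
three PRIVATE fits with the (B) column read PRIMED: `cA k + (eT k + eJ k) ≤ cc k`, `cA′ k + (eB′ k + eT′ k + eJ′ k) ≤ cc′ k`, `a + (X 0 + eT′ 0 + eJ′ 0) ≤ x₀/2`.
Output: the private pair `TwoLegReadJetBound L M cc cc′ … K_{m+1} (m+1) ∧ TwoLegReadOscAt L M x₀ … K_{m+1} (m+1)`.

* **`twoLegReadPriv_flow_succ_of_pos_pure`**.

Composition only; no definitions; nothing asserts any stub of 20437, K3, the margin or superconductivity.  References: BGM 2006 §2.4 Lemma 2.1 (2.36)–(2.42)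
[cite: BenfattoGiulianiMastropietro2006]; FST 1996 §1 [cite: FeldmanSalmhoferTrubowitz1996].
-/

noncomputable section

namespace Summit.HubbardSuperconductivity.HubbardSuperconductivity.Theorems.EngineV8

set_option linter.dupNamespace false -- summit = problem name (single-conjunct summit), D-0017
set_option exponentiation.threshold 1024 -- `2^200` literal in the budget expressions

open Complex Real Finset Filter Literature.MathematicalPhysics.QuantumLattice Literature.Probability.LatticeModels GrassmannAlgebra
open Literature.MathematicalPhysics.QuantumLattice.BandSectorCounting Literature.MathematicalPhysics.QuantumLattice.FermiRG
open Summit.HubbardSuperconductivity.HubbardSuperconductivity.Theorems.KLRegimeSplit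
open Summit.HubbardSuperconductivity.HubbardSuperconductivity.Theorems.DispersionFlow
open Summit.HubbardSuperconductivity.HubbardSuperconductivity.Theorems.KLProgrammeLegKernels
open Summit.HubbardSuperconductivity.HubbardSuperconductivity.Theorems.PerturbedFermiCurve
open scoped Nat

section PrivStepOfPosPure

variable {L M : ℕ} [NeZero L] [NeZero M]

/-- **THE (P)-STEP AT A GENERAL SCALE WITH THE (B) BRACKET DISCHARGED BY NAME (primed booking)** — see the module docstring.
[cite: BenfattoGiulianiMastropietro2006, §2.4 Lemma 2.1 (2.36)–(2.42)] -/
theorem twoLegReadPriv_flow_succ_of_pos_pure {R : RenConsts} (hR : ∀ j, 0 ≤ R.Gfr j) {c : ℝ} (hc : 0 < c) (hcle : c ≤ klCurveC3 R)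
    {U : ℝ} (hU : 0 < U) (hU1 : U ≤ 1) (hUle : U ≤ klCurveU0 R) {β : ℝ} (hβmin : klBetaMin ≤ β) (hβc : β ≤ Real.exp (c / U ^ 2))
    {μ : ℝ} (hμ : μ ∈ klWindowC) (m : ℕ) (hm1 : m + 1 ≤ nScales β)
    {G : GeoConsts} {Q : EngConsts} (hGS : ∀ k, 0 ≤ G.S k) (hQS : ∀ k, 0 ≤ Q.S' k)
    {Nf₁ N : ℕ} (hOK₁ : FrameOK R U Nf₁ μ (klFlowFrameU L M β U μ m)) (hOK₂ : FrameOK R U N μ (klFlowFrameU L M β U μ (m + 1))) (hNn : N ≤ m + 1)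
    (hZ₂ : IsUnit (effPartitionFn ℂ (normalCovariance L M (uvSymbolCT L M β μ (klFlowFrameU L M β U μ (m + 1)) (klScale klE0 m))) (hubbardInteraction L M β U + counterQuadratic L M β (klFlowFrameU L M β U μ (m + 1)))))
    (hZ : ∀ t ∈ Set.Icc (0 : ℝ) 1, effPartitionFn ℂ
      (normalCovariance L M (uvSymbolCT L M β μ (klFlowFrameU L M β U μ m) (klScale klE0 m)) + ((t : ℂ)) • (normalCovariance L M (fun ks => uvSymbolCT L M β μ (klFlowFrameU L M β U μ (m + 1)) (klScale klE0 m) ks / (1 + uvSymbolCT L M β μ (klFlowFrameU L M β U μ (m + 1)) (klScale klE0 m) ks * (((fsub (klFlowFrameU L M β U μ (m + 1)) (klFlowFrameU L M β U μ m)).eval (latticeMomentum L ks.1.2) / (β * (L : ℝ) ^ 2) : ℝ) : ℂ))) - normalCovariance L M (uvSymbolCT L M β μ (klFlowFrameU L M β U μ m) (klScale klE0 m)))) (hubbardInteraction L M β U + counterQuadratic L M β (klFlowFrameU L M β U μ m)) ≠ 0)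
    -- the flow history and the closed envelopes (verbatim from the door)
    {n : ℕ} (hP : ∀ m' ≤ n, FlowPieceJetsAt L M β U μ R m') (hTJ : ∀ m' ≤ n, TwoLegReadJetsF L M G Q β U μ m') (hmn : m ≤ n)
    (hR0 : 0 < R.Gfr 0) {W Ξ Θ : ℝ} (hW : W = curveExtC (8 * 576 * (342 : ℝ) ^ 4) G.S 1 + curveExtC (8 * 576 * (342 : ℝ) ^ 4) Q.S' 1 * |U|)
    (hΞ : Ξ = (2 ^ 10 * (1 + Real.pi ^ 8 * (W * U ^ 2) / 2 ^ 11) + ∑ j ∈ range 5, R.Gfr j))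
    (hΘ : Θ = (1 + ((∑ j ∈ range 5, R.Gfr j) + Real.pi ^ 8 * W / 2 ^ 11) * |U| / R.Gfr 0))
    (hdoor : R.Gfr 0 * |U| + ((∑ j ∈ range 5, R.Gfr j) + Real.pi ^ 8 * W / 2 ^ 11) * U ^ 2 ≤ 1 / 128) {P : SplitConsts} (hL : klEngL₄ P R β U ≤ L)
    {s : ℕ} (hs : 30 ≤ s)
    -- E1: β-free graded constant families (four-leg: PURE weight, `U²` law at orders ≥ 1)
    {cN cS cE : ℕ → ℝ} {cSs cEs : ℝ} (hcN : ∀ l, 0 ≤ cN l) (hcS : ∀ l, 0 ≤ cS l) (hcE : ∀ l, 0 ≤ cE l) (hcSs : 0 ≤ cSs) (hcEs : 0 ≤ cEs)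
    (hNp0 : ∀ t ∈ Set.Icc (0 : ℝ) 1, ∀ (σ : Fin 2) (A : HubbardFieldIdx L M) (x₀ : SpaceTimeIdx L M), imagTimeWeight β M ^ 3 *
      ∑ x ∈ (univ : Finset (Fin 4 → SpaceTimeIdx L M)).filter (fun x => x 0 = x₀),
        (((((x 1).2 - (x 0).2) 0).valMinAbs.natAbs : ℝ) + ((((x 1).2 - (x 0).2) 1).valMinAbs.natAbs : ℝ)) ^ 0 *
          ‖sectorisedKernel L M β (trivialMultiplier L M)
            (effAction ℂ (normalCovariance L M (uvSymbolCT L M β μ (klFlowFrameU L M β U μ m) (klScale klE0 m)) + ((t : ℂ)) • (normalCovariance L M (fun ks => uvSymbolCT L M β μ (klFlowFrameU L M β U μ (m + 1)) (klScale klE0 m) ks / (1 + uvSymbolCT L M β μ (klFlowFrameU L M β U μ (m + 1)) (klScale klE0 m) ks * (((fsub (klFlowFrameU L M β U μ (m + 1)) (klFlowFrameU L M β U μ m)).eval (latticeMomentum L ks.1.2) / (β * (L : ℝ) ^ 2) : ℝ) : ℂ))) - normalCovariance L M (uvSymbolCT L M β μ (klFlowFrameU L M β U μ m) (klScale klE0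 m)))) (hubbardInteraction L M β U + counterQuadratic L M β (klFlowFrameU L M β U μ m))) 4
            (![((0, σ), 0), ((0, σ), 1), ((0, A.1.2), 1 - A.2), ((0, A.1.2), A.2)] : Fin 4 → SectorLeg 1) x‖ ≤ cN 0 * U)
    (hNp : ∀ l, 1 ≤ l → l ≤ 4 → ∀ t ∈ Set.Icc (0 : ℝ) 1, ∀ (σ : Fin 2) (A : HubbardFieldIdx L M) (x₀ : SpaceTimeIdx L M), imagTimeWeight β M ^ 3 *
      ∑ x ∈ (univ : Finset (Fin 4 → SpaceTimeIdx L M)).filter (fun x => x 0 = x₀),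
        (((((x 1).2 - (x 0).2) 0).valMinAbs.natAbs : ℝ) + ((((x 1).2 - (x 0).2) 1).valMinAbs.natAbs : ℝ)) ^ l *
          ‖sectorisedKernel L M β (trivialMultiplier L M)
            (effAction ℂ (normalCovariance L M (uvSymbolCT L M β μ (klFlowFrameU L M β U μ m) (klScale klE0 m)) + ((t : ℂ)) • (normalCovariance L M (fun ks => uvSymbolCT L M β μ (klFlowFrameU L M β U μ (m + 1)) (klScale klE0 m) ks / (1 + uvSymbolCT L M β μ (klFlowFrameU L M β U μ (m + 1)) (klScale klE0 m) ks * (((fsub (klFlowFrameU L M β U μ (m + 1)) (klFlowFrameU L M β U μ m)).eval (latticeMomentum L ks.1.2) / (β * (L : ℝ) ^ 2) : ℝ) : ℂ))) - normalCovariance L M (uvSymbolCT L M β μ (klFlowFrameU L M β U μ m) (klScale klE0 m)))) (hubbardInteraction L M β U + counterQuadratic L M β (klFlowFrameU L M β U μ m))) 4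
            (![((0, σ), 0), ((0, σ), 1), ((0, A.1.2), 1 - A.2), ((0, A.1.2), A.2)] : Fin 4 → SectorLeg 1) x‖ ≤ cN l * U ^ 2 * ((4 : ℝ) ^ m) ^ l)
    (hSp : ∀ l ≤ 4, ∀ t ∈ Set.Icc (0 : ℝ) 1, ∀ (σ : Fin 2) (x₀ : SpaceTimeIdx L M),
      (imagTimeWeight β M * ∑ x ∈ (univ : Finset (Fin 2 → SpaceTimeIdx L M)).filter (fun x => x 0 = x₀),
        (1 + ((((x 1).2 - (x 0).2) 0).valMinAbs.natAbs : ℝ) + ((((x 1).2 - (x 0).2) 1).valMinAbs.natAbs : ℝ)) ^ l *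
          ‖sectorisedKernel L M β (trivialMultiplier L M)
            (effAction ℂ (normalCovariance L M (uvSymbolCT L M β μ (klFlowFrameU L M β U μ m) (klScale klE0 m)) + ((t : ℂ)) • (normalCovariance L M (fun ks => uvSymbolCT L M β μ (klFlowFrameU L M β U μ (m + 1)) (klScale klE0 m) ks / (1 + uvSymbolCT L M β μ (klFlowFrameU L M β U μ (m + 1)) (klScale klE0 m) ks * (((fsub (klFlowFrameU L M β U μ (m + 1)) (klFlowFrameU L M β U μ m)).eval (latticeMomentum L ks.1.2) / (β * (L : ℝ) ^ 2) : ℝ) : ℂ))) - normalCovariance L M (uvSymbolCT L M β μ (klFlowFrameU L M β U μ m) (klScale klE0 m)))) (hubbardInteraction L M β U + counterQuadratic L M β (klFlowFrameU L M β U μ m))) 2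
            (![((0, σ), 0), ((0, σ), 1)] : Fin 2 → SectorLeg 1) x‖ ≤ cS l * U * ((4 : ℝ) ^ m) ^ l))
    (hSps : ∀ t ∈ Set.Icc (0 : ℝ) 1, ∀ (σ : Fin 2) (x₀ : SpaceTimeIdx L M),
      (imagTimeWeight β M * ∑ x ∈ (univ : Finset (Fin 2 → SpaceTimeIdx L M)).filter (fun x => x 0 = x₀),
        (1 + ((((x 1).2 - (x 0).2) 0).valMinAbs.natAbs : ℝ) + ((((x 1).2 - (x 0).2) 1).valMinAbs.natAbs : ℝ)) ^ s *
          ‖sectorisedKernel L M β (trivialMultiplier L M)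
            (effAction ℂ (normalCovariance L M (uvSymbolCT L M β μ (klFlowFrameU L M β U μ m) (klScale klE0 m)) + ((t : ℂ)) • (normalCovariance L M (fun ks => uvSymbolCT L M β μ (klFlowFrameU L M β U μ (m + 1)) (klScale klE0 m) ks / (1 + uvSymbolCT L M β μ (klFlowFrameU L M β U μ (m + 1)) (klScale klE0 m) ks * (((fsub (klFlowFrameU L M β U μ (m + 1)) (klFlowFrameU L M β U μ m)).eval (latticeMomentum L ks.1.2) / (β * (L : ℝ) ^ 2) : ℝ) : ℂ))) - normalCovariance L M (uvSymbolCT L M β μ (klFlowFrameU L M β U μ m) (klScale klE0 m)))) (hubbardInteraction L M β U + counterQuadratic L M β (klFlowFrameU L M β U μ m))) 2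
            (![((0, σ), 0), ((0, σ), 1)] : Fin 2 → SectorLeg 1) x‖ ≤ cSs * U * ((4 : ℝ) ^ m) ^ s))
    (hSEp : ∀ l ≤ 4, ∀ (σ : Fin 2) (x₀ : SpaceTimeIdx L M),
      (imagTimeWeight β M * ∑ x ∈ (univ : Finset (Fin 2 → SpaceTimeIdx L M)).filter (fun x => x 0 = x₀),
        (1 + ((((x 1).2 - (x 0).2) 0).valMinAbs.natAbs : ℝ) + ((((x 1).2 - (x 0).2) 1).valMinAbs.natAbs : ℝ)) ^ l *
          ‖sectorisedKernel L M β (trivialMultiplier L M)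
            (effAction ℂ (normalCovariance L M (fun ks => uvSymbolCT L M β μ (klFlowFrameU L M β U μ (m + 1)) (klScale klE0 m) ks / (1 + uvSymbolCT L M β μ (klFlowFrameU L M β U μ (m + 1)) (klScale klE0 m) ks * (((fsub (klFlowFrameU L M β U μ (m + 1)) (klFlowFrameU L M β U μ m)).eval (latticeMomentum L ks.1.2) / (β * (L : ℝ) ^ 2) : ℝ) : ℂ)))) (hubbardInteraction L M β U + counterQuadratic L M β (klFlowFrameU L M β U μ m))) 2
            (![((0, σ), 0), ((0, σ), 1)] : Fin 2 → SectorLeg 1) x‖ ≤ cE l * U * ((4 : ℝ) ^ m) ^ l))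
    (hSEs : ∀ (σ : Fin 2) (x₀ : SpaceTimeIdx L M),
      (imagTimeWeight β M * ∑ x ∈ (univ : Finset (Fin 2 → SpaceTimeIdx L M)).filter (fun x => x 0 = x₀),
        (1 + ((((x 1).2 - (x 0).2) 0).valMinAbs.natAbs : ℝ) + ((((x 1).2 - (x 0).2) 1).valMinAbs.natAbs : ℝ)) ^ s *
          ‖sectorisedKernel L M β (trivialMultiplier L M)
            (effAction ℂ (normalCovariance L M (fun ks => uvSymbolCT L M β μ (klFlowFrameU L M β U μ (m + 1)) (klScale klE0 m) ks / (1 + uvSymbolCT L M β μ (klFlowFrameU L M β U μ (m + 1)) (klScale klE0 m) ks * (((fsub (klFlowFrameU L M β U μ (m + 1)) (klFlowFrameU L M β U μ m)).eval (latticeMomentum L ks.1.2) / (β * (L : ℝ) ^ 2) : ℝ) : ℂ)))) (hubbardInteraction L M β U + counterQuadratic L M β (klFlowFrameU L M β U μ m))) 2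
            (![((0, σ), 0), ((0, σ), 1)] : Fin 2 → SectorLeg 1) x‖ ≤ cEs * U * ((4 : ℝ) ^ m) ^ s))
    -- the (B) budget word as a primed table
    {X : ℕ → ℝ} (hX0 : ∀ l, 0 ≤ X l)
    (hXv : 2 ^ 32 / 4 ^ 0 * R.Gfr 0 * cN 0 + (klEngRsq R ^ 4 * (cS 0 ^ 2 + cE 0 + 1) + (cSs ^ 2 + cEs + 1)) / 2 ^ 200 ≤ X 0)
    (hX : ∀ l, 1 ≤ l → l ≤ 4 → 2 ^ 32 / 4 ^ l * R.Gfr 0 * cN l + (klEngRsq R ^ 4 * (cS l ^ 2 + cE l + 1) + (cSs ^ 2 + cEs + 1)) / 2 ^ 200 ≤ X l)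
    -- the (P)-step's other inputs (k3c3-p1 `twoLegReadPriv_flow_succ` at `n := m`)
    (hLdeg : 4 * klFlowDeg (m + 1) ≤ L)
    {cA cA' eT eT' eJ eJ' cc cc' : ℕ → ℝ} {τA a x₀ : ℝ}
    -- (A): slice-increment jets and structured value at the new frame
    (hA : TwoLegCurveJetBound L M cA cA' β U μ (klFlowFrameU L M β U μ (m + 1)) (m + 1))
    (hAval : ∀ θ : ℝ, |klTwoLegCurveProfile L M β U μ (klFlowFrameU L M β U μ (m + 1)) (m + 1) θ - τA| ≤
      a * U ^ 2 * (4 : ℝ) ^ (-2 * ((m + 1 : ℕ) : ℤ)))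
    -- (C2): transport
    (hTdiff : ContDiff ℝ 4 fun θ : ℝ =>
      (symInterp L (klLocSelfEnergyRe L M β U μ (klFlowFrameU L M β U μ m) m)).eval (klFermiPoint μ (klFlowFrameU L M β U μ (m + 1)) θ) -
        klLocalPart L M β U μ (klFlowFrameU L M β U μ m) m θ)
    (hT : ∀ k ≤ 4, ∀ θ : ℝ, |iteratedDeriv k (fun θ : ℝ =>
      (symInterp L (klLocSelfEnergyRe L M β U μ (klFlowFrameU L M β U μ m) m)).eval (klFermiPoint μ (klFlowFrameU L M β U μ (m + 1)) θ) -
        klLocalPart L M β U μ (klFlowFrameU L M β U μ m) m θ) θ| ≤ curveJetBar eT eT' U k (m + 1))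
    -- (C1): Jackson remainder
    (hJdiff : ContDiff ℝ 4 fun θ : ℝ => klLocalPart L M β U μ (klFlowFrameU L M β U μ m) m θ -
      (klFlowPiece L M β U μ m).eval (klFermiPoint μ (klFlowFrameU L M β U μ (m + 1)) θ))
    (hJ : ∀ k ≤ 4, ∀ θ : ℝ, |iteratedDeriv k (fun θ : ℝ => klLocalPart L M β U μ (klFlowFrameU L M β U μ m) m θ -
      (klFlowPiece L M β U μ m).eval (klFermiPoint μ (klFlowFrameU L M β U μ (m + 1)) θ)) θ| ≤ curveJetBar eJ eJ' U k (m + 1))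
    (heT0 : eT 0 = 0) (heJ0 : eJ 0 = 0)
    -- the three private fits, (B) column read PRIMED
    (hfit : ∀ k, cA k + (eT k + eJ k) ≤ cc k)
    (hfit' : ∀ k, cA' k + ((if k = 0 then X 0 else readJetC X k + readJetC' R X k) + eT' k + eJ' k) ≤ cc' k)
    (hfitO : a + (X 0 + eT' 0 + eJ' 0) ≤ x₀ / 2) :
    TwoLegReadJetBound L M cc cc' β U μ (klFlowFrameU L M β U μ (m + 1)) (m + 1) ∧
      TwoLegReadOscAt L M x₀ β U μ (klFlowFrameU L M β U μ (m + 1)) (m + 1) := by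
  obtain ⟨hBdiff, hB⟩ := frameResponse_hB_flow_of_pos_pure_primed hR hc hcle hU hU1 hUle hβmin hβc hμ m hm1 hGS hQS hOK₁ hOK₂ hNn hZ₂ hZ hP hTJ hmn hR0 hW hΞ hΘ
    hdoor hL hs hcN hcS hcE hcSs hcEs hNp0 hNp hSp hSps hSEp hSEs hX0 hXv hX
  have hfit2 : ∀ k, cA k + ((fun _ : ℕ => (0 : ℝ)) k + eT k + eJ k) ≤ cc k := fun k => by simpa using hfit k
  have e0 : (fun k : ℕ => if k = 0 then X 0 else readJetC X k + readJetC' R X k) 0 = X 0 := if_pos rfl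
  have hfitO2 : a + ((fun k : ℕ => if k = 0 then X 0 else readJetC X k + readJetC' R X k) 0 + eT' 0 + eJ' 0) ≤ x₀ / 2 := by rw [e0]; exact hfitO
  exact twoLegReadPriv_flow_succ β U μ hLdeg hA hAval hBdiff hB hTdiff hT hJdiff hJ rfl heT0 heJ0 hfit2 (fun k => hfit' k) hfitO2

end PrivStepOfPosPure

end Summit.HubbardSuperconductivity.HubbardSuperconductivity.Theorems.EngineV8

end
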